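import Summits.QuantumFields.YangMills.Theorems.BalabanUVNodesN19HingeLinksMultiscale
import Summits.QuantumFields.YangMills.Theorems.BalabanUVNodesN19SmoothLinksMultiscale
import Summits.QuantumFields.YangMills.Theorems.BalabanUVNodesN19JacksonTotalDegreeDimension

/-!
# YM-DAG node N19 (= NE7 proper) — MULTISCALE TELESCOPING, PART 6: THE LAW-LEVEL FACE — two probability laws on `[−1,1]^d` with EQUAL mixed moments
# of total degree `≤ t` integrate the oscillating ∕ hinge ∕ C² links of the ℓ¹-norm `Σ_i|x_i|` to within `≲ d·log²t∕t` (the `W₁` form of (v′), for these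
# test classes)

Cell `pub-ymgap`, HUMAN RULING D-0062 (Track A) ∕ D-0149 (work-bound push), R141 (C) wider-strategy seat `pub-ymgap-dag-n19-e` (strategy
s3 = ALTERNATIVE CURRENCY), generation g30, module 8 (lineage module 125).  Route `Summits/QuantumFields/YangMills/Theses/BalabanUVNodes.lean`,
cluster item K3⁸ «SpineGivenEndpointR13SepCoPHV» (stmt-QuantumFields-27366); filed `--supports` that item `--as helper` (it proves no registered
stub).  COUNT-NEUTRAL: [folklore] over Mathlib and the lineage BY NAME — module 109 `…N19JacksonTotalDegreeDimension`
(`integral_mvPolynomial_eq_of_moments`), module 65 `…N19JointLawPriceDimension` (`abs_integral_le_of_cube`), module 62 `…N19JointLawBernstein`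
(`integrable_of_continuous_of_cube`), PART 2b (`exists_mvPolynomial_near_cos_l1Norm_degree` ∕ `…_sin_…`), PART 4 (`exists_mvPolynomial_near_hinge_l1Norm_degree`),
PART 5b (`exists_mvPolynomial_near_smoothLink_l1Norm_degree`); TOY laws under HYPOTHESES, no scheme object, no Theses import; NOT a discharge claim.

CONTENT.  OPEN-PROBLEM.md states (v′) in its `W₁` form: for probability laws `P, Q` on `[−1,1]^k` agreeing on `Π_t`, bound `|E_P φ(|x|₁) − E_Q φ(|x|₁)|`
over 1-Lipschitz `φ` by `C·k∕t`.  §1 `abs_integral_sub_integral_le_of_near` (THE TRANSFER: `|g − F| ≤ ε` on the cube with `deg F ≤ t` and equal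
moments of total degree `≤ t` ⇒ `|∫g dP − ∫g dQ| ≤ 2ε`) · §2 ★★ `abs_integral_cos_l1Norm_sub_le_of_moments` ∕ `…_sin_…` (single modes:
`≤ 600·log₂t·(log₂t + 4ωd)∕t`, `t ≥ 8`) · ★★ `abs_integral_hinge_l1Norm_sub_le_of_moments` (hinges `|S − c|`, `c ∈ [0,d]`: `≤ 400·d·log₂t·(log₂t + 7)∕t`,
`t ≥ 18432`) · ★★ `abs_integral_smoothLink_l1Norm_sub_le_of_moments` (C² links: `≤ 100·V·d·log₂t·(log₂t + 19)∕t`, `t ≥ 18432`).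
READING for (v′) (honest): the `W₁` form holds at the conjectured rate up to `log²t` UNIFORMLY over the test classes {single modes of frequency `ω`}
(weight `1 + ωd∕log t`), {hinges}, {C² links with `V ≤ V₀`}; the full 1-Lipschitz ball (= `W₁` of the laws of `Σ|x_i|`) stays OPEN.  In the lineage's
MOMENT currency (all mixed moments `r`-close rather than equal up to degree `t`) the same statements need the degree → mass transfer (not typed).

HONEST FRAMING (binding).  Elementary and [folklore]; TOY laws under hypotheses; NO consumer in the DAG today; nothing of Bałaban's instantiated; NE7 NOT
PRINTED, NOT proved; N19 NOT discharged; count-neutral.  One finite `T⁴` programme at fixed `ε`; nothing continuum ∕ `ℝ⁴` ∕ OS ∕ mass-gap ∕ Clay.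
0 `def` ∕ 0 `sorry`.
-/

noncomputable section

open Real Finset MeasureTheory

namespace Summit.QuantumFields.YangMills.Theorems.BalabanUVNodesN19OscillatingLinksMomentDiscrepancy

open Summit.QuantumFields.YangMills.Theorems.BalabanUVNodesN19JacksonTotalDegreeDimension (integral_mvPolynomial_eq_of_moments)
open Summit.QuantumFields.YangMills.Theorems.BalabanUVNodesN19JointLawPriceDimension (abs_integral_le_of_cube)
open Summit.QuantumFields.YangMills.Theorems.BalabanUVNodesN19JointLawBernstein (integrable_of_continuous_of_cube)
open Summit.QuantumFields.YangMills.Theorems.BalabanUVNodesN19SingleModeDegreeBudget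
  (exists_mvPolynomial_near_cos_l1Norm_degree exists_mvPolynomial_near_sin_l1Norm_degree)
open Summit.QuantumFields.YangMills.Theorems.BalabanUVNodesN19HingeLinksMultiscale (exists_mvPolynomial_near_hinge_l1Norm_degree)
open Summit.QuantumFields.YangMills.Theorems.BalabanUVNodesN19SmoothLinksMultiscale (exists_mvPolynomial_near_smoothLink_l1Norm_degree)

variable {ι : Type*} [Fintype ι]

/-! ## §1 The transfer from sup-norm approximation to moment-matched laws [folklore] -/

/-- **TRANSFER.**  Let `P, Q` be probability laws on `ℝ^ι` carried by `[−1,1]^ι` with EQUAL mixed moments of total degree `≤ t`, `g` continuous with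
`|g(x) − F(x)| ≤ ε` on the cube for some `F : MvPolynomial ι ℝ` of total degree `≤ t`.  Then `|∫g dP − ∫g dQ| ≤ 2ε`
(`∫F dP = ∫F dQ` by module 109; the two remainders are `≤ ε` each). [folklore] -/
theorem abs_integral_sub_integral_le_of_near {P Q : Measure (ι → ℝ)} [IsProbabilityMeasure P] [IsProbabilityMeasure Q]
    (hP : P (Set.pi Set.univ (fun _ : ι => Set.Icc (-1 : ℝ) 1))ᶜ = 0) (hQ : Q (Set.pi Set.univ (fun _ : ι => Set.Icc (-1 : ℝ) 1))ᶜ = 0)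
    {t : ℕ} (hmom : ∀ j : ι → ℕ, ∑ i, j i ≤ t → ∫ x, ∏ i, x i ^ j i ∂P = ∫ x, ∏ i, x i ^ j i ∂Q)
    {g : (ι → ℝ) → ℝ} (hg : Continuous g) {F : MvPolynomial ι ℝ} (hF : F.totalDegree ≤ t) {ε : ℝ}
    (happ : ∀ x : ι → ℝ, (∀ i, x i ∈ Set.Icc (-1 : ℝ) 1) → |g x - MvPolynomial.eval x F| ≤ ε) :
    |∫ x, g x ∂P - ∫ x, g x ∂Q| ≤ 2 * ε := by
  have hFc : Continuous fun x : ι → ℝ => MvPolynomial.eval x F := MvPolynomial.continuous_eval F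
  have hgF : Continuous fun x : ι → ℝ => g x - MvPolynomial.eval x F := hg.sub hFc
  have hsplit : ∀ (μ : Measure (ι → ℝ)) [IsProbabilityMeasure μ], μ (Set.pi Set.univ (fun _ : ι => Set.Icc (-1 : ℝ) 1))ᶜ = 0 →
      ∫ x, g x ∂μ = ∫ x, (g x - MvPolynomial.eval x F) ∂μ + ∫ x, MvPolynomial.eval x F ∂μ := by
    intro μ _ hμ
    rw [← integral_add (integrable_of_continuous_of_cube hμ hgF) (integrable_of_continuous_of_cube hμ hFc)]
    refine integral_congr_ae (Filter.Eventually.of_forall fun x => ?_)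
    simp only [sub_add_cancel]
  have hmomF := integral_mvPolynomial_eq_of_moments hP hQ hmom hF
  rw [hsplit P hP, hsplit Q hQ, hmomF, add_sub_add_right_eq_sub]
  have h1 := abs_integral_le_of_cube hP (f := fun x => g x - MvPolynomial.eval x F) happ
  have h2 := abs_integral_le_of_cube hQ (f := fun x => g x - MvPolynomial.eval x F) happ
  calc |∫ x, (g x - MvPolynomial.eval x F) ∂P - ∫ x, (g x - MvPolynomial.eval x F) ∂Q|
      ≤ |∫ x, (g x - MvPolynomial.eval x F) ∂P| + |∫ x, (g x - MvPolynomial.eval x F) ∂Q| := abs_sub _ _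
    _ ≤ ε + ε := add_le_add h1 h2
    _ = 2 * ε := by ring

/-- The ℓ¹-norm is continuous. [bookkeeping] -/
theorem continuous_l1Norm : Continuous fun x : ι → ℝ => ∑ i, |x i| :=
  continuous_finsetSum _ fun i _ => (continuous_apply i).abs

/-! ## §2 ★★ The law-level faces [folklore] -/

/-- ★★ **SINGLE MODES, LAW LEVEL.**  For probability laws `P, Q` carried by `[−1,1]^ι` with equal mixed moments of total degree `≤ t` (`t ≥ 8`) and
`ω ≥ 0`: `|∫cos(ωΣ_i|x_i|)dP − ∫cos(ωΣ_i|x_i|)dQ| ≤ 600·log₂t·(log₂t + 4ωd)∕t` (`d = |ι|`). [folklore] -/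
theorem abs_integral_cos_l1Norm_sub_le_of_moments {P Q : Measure (ι → ℝ)} [IsProbabilityMeasure P] [IsProbabilityMeasure Q]
    (hP : P (Set.pi Set.univ (fun _ : ι => Set.Icc (-1 : ℝ) 1))ᶜ = 0) (hQ : Q (Set.pi Set.univ (fun _ : ι => Set.Icc (-1 : ℝ) 1))ᶜ = 0)
    {t : ℕ} (ht : 8 ≤ t) (hmom : ∀ j : ι → ℕ, ∑ i, j i ≤ t → ∫ x, ∏ i, x i ^ j i ∂P = ∫ x, ∏ i, x i ^ j i ∂Q)
    {ω : ℝ} (hω : 0 ≤ ω) :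
    |∫ x, Real.cos (ω * ∑ i, |x i|) ∂P - ∫ x, Real.cos (ω * ∑ i, |x i|) ∂Q| ≤
      600 * Real.logb 2 t * (Real.logb 2 t + 4 * ω * Fintype.card ι) / t := by
  obtain ⟨F, hF, happ⟩ := exists_mvPolynomial_near_cos_l1Norm_degree (ι := ι) ht hω
  have hg : Continuous fun x : ι → ℝ => Real.cos (ω * ∑ i, |x i|) :=
    Real.continuous_cos.comp (continuous_const.mul continuous_l1Norm)
  have h := abs_integral_sub_integral_le_of_near hP hQ hmom hg hF happ
  refine h.trans_eq ?_
  ring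

/-- ★★ **SINGLE MODES (sine), LAW LEVEL**: `|∫sin(ωΣ_i|x_i|)dP − ∫sin(ωΣ_i|x_i|)dQ| ≤ 600·log₂t·(log₂t + 4ωd)∕t`. [folklore] -/
theorem abs_integral_sin_l1Norm_sub_le_of_moments {P Q : Measure (ι → ℝ)} [IsProbabilityMeasure P] [IsProbabilityMeasure Q]
    (hP : P (Set.pi Set.univ (fun _ : ι => Set.Icc (-1 : ℝ) 1))ᶜ = 0) (hQ : Q (Set.pi Set.univ (fun _ : ι => Set.Icc (-1 : ℝ) 1))ᶜ = 0)
    {t : ℕ} (ht : 8 ≤ t) (hmom : ∀ j : ι → ℕ, ∑ i, j i ≤ t → ∫ x, ∏ i, x i ^ j i ∂P = ∫ x, ∏ i, x i ^ j i ∂Q)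
    {ω : ℝ} (hω : 0 ≤ ω) :
    |∫ x, Real.sin (ω * ∑ i, |x i|) ∂P - ∫ x, Real.sin (ω * ∑ i, |x i|) ∂Q| ≤
      600 * Real.logb 2 t * (Real.logb 2 t + 4 * ω * Fintype.card ι) / t := by
  obtain ⟨F, hF, happ⟩ := exists_mvPolynomial_near_sin_l1Norm_degree (ι := ι) ht hω
  have hg : Continuous fun x : ι → ℝ => Real.sin (ω * ∑ i, |x i|) :=
    Real.continuous_sin.comp (continuous_const.mul continuous_l1Norm)
  have h := abs_integral_sub_integral_le_of_near hP hQ hmom hg hF happ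
  refine h.trans_eq ?_
  ring

/-- ★★ **HINGES, LAW LEVEL.**  For `P, Q` as above with equal mixed moments of total degree `≤ t` (`t ≥ 18432`) and every `c ∈ [0,d]`:
`|∫|Σ_i|x_i| − c| dP − ∫|Σ_i|x_i| − c| dQ| ≤ 400·d·log₂t·(log₂t + 7)∕t` — uniformly in the kink position. [folklore] -/
theorem abs_integral_hinge_l1Norm_sub_le_of_moments {P Q : Measure (ι → ℝ)} [IsProbabilityMeasure P] [IsProbabilityMeasure Q]
    (hP : P (Set.pi Set.univ (fun _ : ι => Set.Icc (-1 : ℝ) 1))ᶜ = 0) (hQ : Q (Set.pi Set.univ (fun _ : ι => Set.Icc (-1 : ℝ) 1))ᶜ = 0)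
    {t : ℕ} (ht : 18432 ≤ t) (hmom : ∀ j : ι → ℕ, ∑ i, j i ≤ t → ∫ x, ∏ i, x i ^ j i ∂P = ∫ x, ∏ i, x i ^ j i ∂Q)
    {c : ℝ} (hc0 : 0 ≤ c) (hcd : c ≤ Fintype.card ι) :
    |∫ x, |(∑ i, |x i|) - c| ∂P - ∫ x, |(∑ i, |x i|) - c| ∂Q| ≤
      400 * Fintype.card ι * Real.logb 2 t * (Real.logb 2 t + 7) / t := by
  obtain ⟨F, hF, happ⟩ := exists_mvPolynomial_near_hinge_l1Norm_degree (ι := ι) ht hc0 hcd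
  have hg : Continuous fun x : ι → ℝ => |(∑ i, |x i|) - c| := (continuous_l1Norm.sub continuous_const).abs
  have h := abs_integral_sub_integral_le_of_near hP hQ hmom hg hF happ
  refine h.trans_eq ?_
  ring

/-- ★★ **C² LINKS, LAW LEVEL.**  For `P, Q` as above with equal mixed moments of total degree `≤ t` (`t ≥ 18432`, `ι` nonempty) and a link `h` with
everywhere derivatives `h′`, `h″`, `h″` continuous, `|h″| ≤ κ` on `[0,d]`, `V = |h′(0)| + |h′(d)| + κd`:
`|∫h(Σ_i|x_i|)dP − ∫h(Σ_i|x_i|)dQ| ≤ 100·V·d·log₂t·(log₂t + 19)∕t`. [folklore] -/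
theorem abs_integral_smoothLink_l1Norm_sub_le_of_moments [Nonempty ι] {P Q : Measure (ι → ℝ)} [IsProbabilityMeasure P]
    [IsProbabilityMeasure Q]
    (hP : P (Set.pi Set.univ (fun _ : ι => Set.Icc (-1 : ℝ) 1))ᶜ = 0) (hQ : Q (Set.pi Set.univ (fun _ : ι => Set.Icc (-1 : ℝ) 1))ᶜ = 0)
    {t : ℕ} (ht : 18432 ≤ t) (hmom : ∀ j : ι → ℕ, ∑ i, j i ≤ t → ∫ x, ∏ i, x i ^ j i ∂P = ∫ x, ∏ i, x i ^ j i ∂Q)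
    {h h' h'' : ℝ → ℝ} (hh : ∀ s, HasDerivAt h (h' s) s) (hh' : ∀ s, HasDerivAt h' (h'' s) s) (hh'' : Continuous h'')
    {κ : ℝ} (hκ : ∀ s ∈ Set.Icc (0 : ℝ) (Fintype.card ι), |h'' s| ≤ κ) :
    |∫ x, h (∑ i, |x i|) ∂P - ∫ x, h (∑ i, |x i|) ∂Q| ≤
      100 * (|h' 0| + |h' (Fintype.card ι)| + κ * Fintype.card ι) * Fintype.card ι * Real.logb 2 t * (Real.logb 2 t + 19) / t := by
  obtain ⟨F, hF, happ⟩ := exists_mvPolynomial_near_smoothLink_l1Norm_degree (ι := ι) hh hh' hh'' hκ ht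
  have hcont_h : Continuous h := continuous_iff_continuousAt.2 fun s => (hh s).continuousAt
  have hg : Continuous fun x : ι → ℝ => h (∑ i, |x i|) := hcont_h.comp continuous_l1Norm
  have h := abs_integral_sub_integral_le_of_near hP hQ hmom hg hF happ
  refine h.trans_eq ?_
  ring

end Summit.QuantumFields.YangMills.Theorems.BalabanUVNodesN19OscillatingLinksMomentDiscrepancy

end
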